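import Summits.BirchSwinnertonDyer.BirchSwinnertonDyer.Theorems.SchneiderFreeAdditiveX3AnticycControlAdditiveNoLocalPTorsionOfFacts
import Summits.BirchSwinnertonDyer.BirchSwinnertonDyer.Theorems.SchneiderFreeAdditiveX3AnticycControlAdditiveRegimeB1
import Summits.BirchSwinnertonDyer.BirchSwinnertonDyer.Theorems.PotentiallySupersingularLocalTowerTorsionFinite
import Literature.NumberTheory.EllipticCurves.BSDSelmerCMPConverseHeegnerFieldProofs
import HarnessLib

/-!
# Anticyclotomic exact control at an ADDITIVE potentially SUPERSINGULAR prime — ANY odd `p`, tame or wild —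
# from published facts only (the K1 doors + Brink + Serre 1967)

Prover seat `bsd-potss-kmc`, gen 20 (cell `bsd-potss`), 2026-08-27. HONEST FRAMING: theorems CONDITIONAL on every
displayed named fact; no definition, no named fact minted, no `sorry`; closes nothing by itself; BSD_p is proved for
no curve. Serves this seat's residuals K9 19200 `WildRankOne` / KT 19984 `TameRankOne` (row B8 «O7-ss» of the
programme: analytic rank one at an additive potentially supersingular prime — «nothing in print»).

WHAT IS PROVED. Gen 16/17 closed the anticyclotomic control EQUALITY of the tree's additive currency
(`SchneiderFree.AdditiveControlOnTreeAt p κ 𝔭 γ (embAt K p 𝔭) P`: at an anticyclotomic frame of an imaginary quadratic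
`K` in which the additive prime `p` splits, `ord_p f_ac(𝟙) = ord_p #Ш(E/K)[p^∞] + 2·(ord_p log_ω P − ord_p [E(K):ℤP])
+ ord_p ∏_{w ∣ N⁺} c_w(E/K)`) on the WILD class O6 at `p = 3` modulo eight published facts
(`UniversalToricDescentControl.wildSplitControlAtThree_of_facts_of_serre1967`). The two K1 doors it rests on —
`SchneiderFreeAdditiveX3.additiveControlOnTreeAt_of_facts_of_noPTorsionPadic` (`E(ℚ_p)[p] = 0`) and
`SchneiderFreeAdditiveX3.additiveControlOnTreeAt_of_facts_of_localTowerTorsionFinite` (regime B1: `E(K)[p] = 0`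
+ Fin_v + non-splitting) — are GENERIC in the odd additive prime `p`, and so is gen 17's Fin_v theorem
`PotentiallySupersingularLocalTorsion.localTowerTorsionFiniteAt_of_potentiallySupersingular` (Serre 1967 §5 Prop. 8).
This file assembles them at EVERY odd additive potentially supersingular prime:

* §1 `not_hasUnitRootAt_baseChange_of_classO5` — on the TAME potentially supersingular class O5 (`(t′) ∪ (G)∧ss`,
  any odd `p`) the unit-root condition fails at every good place above `p` of every number field (the hypothesis of
  Serre's fact), from the census dictionary (`ClassO5.not_typeGOrd` + `typeGOrd_of_good_unitRoot_baseChange` at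
  `p ≥ 5`, `typeGOrd_three_iff_exists_good_unitRoot` at `p = 3`); `noStableDivisibleLine_of_classO5`,
  `localTowerTorsionFiniteClaim_of_classO5` (Fin_v on the whole tame class, modulo Serre 1967).
* §2 **`additiveControlOnTreeAt_potSS_of_facts_of_serre1967`** — GENERIC `p`: for `E/ℚ` additive at an odd `p`
  with `ord_p j ≥ 0` and no unit root above `p` anywhere (potentially supersingular in the sense of the fact), `K`
  imaginary quadratic with `p` split, `E(K)[p] = 0`, `rank E(K) = 1`, `Ш(E/K)` finite, `P ∈ E(K)` non-torsion:
  control holds at EVERY anticyclotomic frame `(κ, γ, 𝔭)` — modulo the five cited facts of the K1 door, Brink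
  Thm 2 / Cor 1 and Serre 1967 §5 Prop. 8 (seven named facts). Corollaries with the class predicates:
  `…_of_classO5` (tame, any odd `p`), `…_of_classO6` (wild `3`), and `…_of_irreducible` (`E(K)[p] = 0` from
  `ρ̄_{E,p}` irreducible — so ALL X4 rows, surjective image or not).
* §3 **`additiveControl_heegner_potSS_of_facts_of_serre1967`** — the same in the binder shape of the routes'
  control items (UTD/SOED 20386, this seat's kernel p548442 `bsdp_of_flatIMCEq_of_control_of_twist`): Heegner datum
  `(N, K, Dt, H, ι, P)`, `L(E^{(d_K)},1) ≠ 0`, `P` = Heegner point non-torsion, Kolyvagin's theorem as antecedent,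
  on `ClassO5 W p ∨ ClassO6 W p` with `ρ̄_{E,p}` irreducible.

So «exact anticyclotomic control at a potentially supersingular additive prime» is PRINT-LEVEL at every odd `p`, not
only at the wild `3`: what a rank-one descent at such a prime still needs beyond published facts is the (∅,0) main
conjecture equality at `(E, p)` and the rank-zero twist (kernel p548442), nothing local at `p`.

References: [JetchevSkinnerWan2017] Thm. 3.3.1, Prop. 3.2.1, Prop. 3.3.4 (arXiv:1512.06894 pp. 10–13); [Castella2018]
Thm. 2.3; [MilneADT2006] I 2.8, 4.10; [Brink2007] Thm. 2, Cor. 1; [Serre1967GroupesPDivisibles] §5 Prop. 8;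
[GreenbergLNM1716] §3 Lemma 3.3; [Kolyvagin1990] Thm. A; [GrossLMS1991] §2; [Delbourgo1998] §1.5 (G).
-/

noncomputable section

open scoped Classical

open WeierstrassCurve NumberField IsDedekindDomain Field Literature.NumberTheory.EllipticCurves
  Literature.NumberTheory.EllipticCurves.ModularForms
  Literature.NumberTheory.EllipticCurves.GreenbergSelmer
  Literature.NumberTheory.GaloisRepresentations
  Literature.NumberTheory.GaloisCohomology
  Literature.NumberTheory.EllipticCurves.Rank1Residual
  Literature.NumberTheory.EllipticCurves.Rank1Residual.Typed
  Summit.BirchSwinnertonDyer.Rank1Residual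
  Summit.BirchSwinnertonDyer.Rank1Residual.Additive
  Summit.BirchSwinnertonDyer.Rank1Residual.X11b
  Summit.BirchSwinnertonDyer.Rank1Residual.X11b.AcSelmer
  Summit.BirchSwinnertonDyer.BirchSwinnertonDyer.Theorems.SchneiderFree
  Summit.BirchSwinnertonDyer.BirchSwinnertonDyer.Theorems.SchneiderFreeControlAtoms
  Summit.BirchSwinnertonDyer.BirchSwinnertonDyer.Theorems.SchneiderFreeAdditiveX3
  Summit.BirchSwinnertonDyer.BirchSwinnertonDyer.Theorems.PotentiallySupersingularLocalTorsion

set_option linter.dupNamespace false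
set_option autoImplicit false

namespace Summit.BirchSwinnertonDyer.BirchSwinnertonDyer.Theorems.AdditivePotSupersingularControl

/-! ## §1 The tame potentially supersingular class O5 satisfies the hypotheses of Serre's fact -/

/-- **The TAME potentially supersingular class O5 is potentially supersingular EVERYWHERE above `p`**: for `E/ℚ`
globally minimal on `ClassO5 W p` (odd additive `p`, `f_p = 2`, `ord_p j ≥ 0`, not (G)-ordinary) and every place
`w ∋ p` of every number field `F` at which `E_F` has good reduction, the unit-root condition FAILS. At `p ≥ 5` a
unit root above `p` forces `TypeGOrd W p` (`typeGOrd_of_good_unitRoot_baseChange`); at `p = 3` likewise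
(`typeGOrd_three_iff_exists_good_unitRoot`); both contradict `ClassO5.not_typeGOrd`.
[cite: Delbourgo1998, §1.5 (G) and Thm. 1 p. 152] -/
theorem not_hasUnitRootAt_baseChange_of_classO5 (W : WeierstrassCurve ℚ) [W.IsElliptic] [W.IsGloballyMinimal]
    (p : ℕ) [hp : Fact p.Prime] (h : ClassO5 W p) {F : Type} [Field F] [NumberField F]
    {w : HeightOneSpectrum (𝓞 F)} (hw : ((p : ℕ) : 𝓞 F) ∈ w.asIdeal)
    (hgood : (W.baseChange F).HasGoodReductionAt w) : ¬ (W.baseChange F).HasUnitRootAt w := by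
  intro hunit
  apply h.not_typeGOrd
  rcases Nat.lt_or_ge p 5 with hlt | h5
  · -- an odd prime below `5` is `3`
    have h3 : p = 3 := by
      have h2 := hp.out.two_le
      have hp2 := h.1
      interval_cases p
      · exact absurd rfl hp2
      · rfl
      · exact absurd hp.out (by decide)
    subst h3
    exact (typeGOrd_three_iff_exists_good_unitRoot W h.2.1).mpr ⟨F, inferInstance, inferInstance, w, hw, hgood, hunit⟩
  · exact typeGOrd_of_good_unitRoot_baseChange W p h5 h.2.1 hw hgood hunit

/-- **`hIrr` on the tame class O5, from Serre 1967 Prop. 8**: for `E/ℚ` globally minimal on `ClassO5 W p`, every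
number field `K` and every `𝔭 ∋ p`, `E(K̄)[p^∞]` has no non-zero `D_𝔭`-stable `p`-divisible subgroup with `≤ p`
points killed by `p` (the hypotheses of the fact are `ClassO5.padicValRat_j_nonneg` and §1). CONDITIONAL on the
named fact. [cite: Serre1967GroupesPDivisibles, §5 Prop. 8] -/
theorem noStableDivisibleLine_of_classO5
    (hS : Serre1967.noStableDivisibleLine_of_potentiallySupersingular)
    (W : WeierstrassCurve ℚ) [W.IsElliptic] [W.IsGloballyMinimal] (p : ℕ) [Fact p.Prime] (h : ClassO5 W p)
    (K : Type) [Field K] [NumberField K] (𝔭 : HeightOneSpectrum (𝓞 K))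
    (h𝔭 : ((p : ℕ) : 𝓞 K) ∈ 𝔭.asIdeal) :
    ∀ N : AddSubgroup ((W.baseChange K).geomPrimaryTorsion p),
      (∀ d ∈ decomp 𝔭, ∀ c ∈ N, d • c ∈ N) → (∀ c ∈ N, ∃ c' ∈ N, p • c' = c) →
      Set.ncard {c : (W.baseChange K).geomPrimaryTorsion p | c ∈ N ∧ p • c = 0} ≤ p → N = ⊥ :=
  hS W p h.padicValRat_j_nonneg
    (fun _F _ _ _w hw hgood ↦ not_hasUnitRootAt_baseChange_of_classO5 W p h hw hgood) K 𝔭 h𝔭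

/-- **Fin_v on the whole TAME potentially supersingular class O5** (`LocalTowerTorsionFiniteClaim W p`: for every
imaginary quadratic `K` with `p` split, every anticyclotomic `ℤ_p`-extension and every `𝔭 ∋ p`, the `p`-primary
torsion of `E` over the local tower is finite), modulo Serre 1967 Prop. 8 — gen 17's generic
`localTowerTorsionFiniteAt_of_potentiallySupersingular` with its two hypotheses supplied by the class.
CONDITIONAL on the named fact. [cite: Serre1967GroupesPDivisibles, §5 Prop. 8] [cite: GreenbergLNM1716, §3 Lemma 3.3 (p. 87)] -/
theorem localTowerTorsionFiniteClaim_of_classO5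
    (hS : Serre1967.noStableDivisibleLine_of_potentiallySupersingular)
    (W : WeierstrassCurve ℚ) [W.IsElliptic] [W.IsGloballyMinimal] (p : ℕ) [Fact p.Prime] (h : ClassO5 W p) :
    LocalTowerTorsionFiniteClaim W p := by
  intro K _ _ hK hsplit κ _hκ 𝔭 h𝔭
  obtain ⟨he, hf⟩ := degreeOne_of_splitsIn hK.1 hsplit h𝔭
  exact localTowerTorsionFiniteAt_of_potentiallySupersingular hS W p h.1 h.padicValRat_j_nonneg
    (fun _F _ _ _w hw hgood ↦ not_hasUnitRootAt_baseChange_of_classO5 W p h hw hgood) K κ 𝔭 h𝔭 he hf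

/-! ## §2 Exact anticyclotomic control at a potentially supersingular additive prime, generic `p` -/

/-- **Exact anticyclotomic control at an additive potentially SUPERSINGULAR prime — ANY odd `p` — from seven
published facts.** For `E/ℚ` globally minimal, additive at the odd prime `p`, with `ord_p j ≥ 0` and no unit root
at any good place above `p` of any number field; `K` imaginary quadratic with `p` split; `E(K)[p] = 0`;
`rank E(K) = 1`, `Ш(E/K)` finite and `P ∈ E(K)` of infinite order: at every anticyclotomic `ℤ_p`-extension `κ`
with topological generator `γ` and every (degree-one) `𝔭 ∋ p`,
`SchneiderFree.AdditiveControlOnTreeAt p κ 𝔭 γ (embAt K p 𝔭) P`. Proof: regime B1's K1 door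
`additiveControlOnTreeAt_of_facts_of_localTowerTorsionFinite` — it carries no potentially-ordinary hypothesis
(the additive local index and the control-map bijection use no unit-root line) — with Fin_v from Serre 1967
(`localTowerTorsionFiniteAt_of_potentiallySupersingular`) and non-splitting from Brink Cor. 1. CONDITIONAL on the
named facts; closes nothing by itself.
[cite: JetchevSkinnerWan2017, Thm. 3.3.1, Prop. 3.2.1, Prop. 3.3.4 (arXiv:1512.06894 pp. 10–13)]
[cite: Castella2018, Thm. 2.3 (arXiv:1704.06608 p. 5)] [cite: MilneADT2006, Ch. I, Thm. 4.10 and Thm. 2.8]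
[cite: Brink2007, Thm. 2 and Cor. 1] [cite: Serre1967GroupesPDivisibles, §5 Prop. 8]
[cite: GreenbergLNM1716, §3 Lemma 3.3 (p. 87)] -/
theorem additiveControlOnTreeAt_potSS_of_facts_of_serre1967
    (hPT : ∀ (K : Type) [Field K] [NumberField K], poitouTate_selmerStructure_duality K)
    (hPT2 : ∀ (K : Type) [Field K] [NumberField K], poitouTate_sha_tateDual K)
    (hEP : ∀ (K : Type) [Field K] [NumberField K] (v : HeightOneSpectrum (𝓞 K)),
      localEulerPoincareCharacteristic (v.adicCompletion K))
    (hcd : fieldCdLE_two_of_numberField)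
    (hBr : ∀ (K : Type) [Field K] [NumberField K] (p : ℕ) [Fact p.Prime],
      ZpExtension.decomp_not_le_kerSubgroup_of_isAnticyclotomic K p)
    (hBr2 : ∀ (K : Type) [Field K] [NumberField K] (p : ℕ) [Fact p.Prime],
      ZpExtension.decomp_not_le_kerSubgroup_above_of_isAnticyclotomic K p)
    (hS : Serre1967.noStableDivisibleLine_of_potentiallySupersingular)
    (W : WeierstrassCurve ℚ) [W.IsElliptic] [W.IsGloballyMinimal] (p : ℕ) [Fact p.Prime] (hp2 : p ≠ 2)
    (hadd : Addv W p) (hj : 0 ≤ padicValRat p W.j)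
    (hss : ∀ (F : Type) [Field F] [NumberField F] (w : HeightOneSpectrum (𝓞 F)),
      ((p : ℕ) : 𝓞 F) ∈ w.asIdeal → (W.baseChange F).HasGoodReductionAt w → ¬ (W.baseChange F).HasUnitRootAt w)
    (K : Type) [Field K] [NumberField K] (hK : IsImaginaryQuadratic K) (hsplit : SplitsIn K p)
    (hivK : ∀ x : (W.baseChange K).toAffine.Point, p • x = 0 → x = 0)
    (κ : ZpExtension K p) (hκ : κ.IsAnticyclotomic) (γ : Field.absoluteGaloisGroup K)
    [Fact (κ.IsTopGenerator γ)] (𝔭 : HeightOneSpectrum (𝓞 K)) (h𝔭 : ((p : ℕ) : 𝓞 K) ∈ 𝔭.asIdeal)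
    (he : 𝔭.asIdeal.ramificationIdx (𝓞 ℚ) = 1) (hf : 𝔭.asIdeal.inertiaDeg (𝓞 ℚ) = 1)
    (hrank : (W.baseChange K).mordellWeilRank = 1) (hSha : (W.baseChange K).ShaFinite)
    (P : (W.baseChange K).toAffine.Point) (hPinf : ¬ IsOfFinAddOrder P) :
    AdditiveControlOnTreeAt p κ 𝔭 γ (embAt K p 𝔭 h𝔭 he hf) P :=
  additiveControlOnTreeAt_of_facts_of_localTowerTorsionFinite (hPT K) (hPT2 K) (hEP K) hcd (hBr K p) hp2
    hadd hK hsplit hκ γ 𝔭 h𝔭 he hf hivK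
    (localTowerTorsionFiniteAt_of_potentiallySupersingular hS W p hp2 hj hss K κ 𝔭 h𝔭 he hf)
    (hBr2 K p hK hp2 κ hκ 𝔭 h𝔭) hrank hSha P hPinf

/-- **Exact anticyclotomic control, generic potentially supersingular `p`, WITHOUT the `E(K)[p] = 0` hypothesis on
the frames with `E(ℚ_p)[p] = 0`** — there the `t_p = 0` K1 door `additiveControlOnTreeAt_of_facts_of_noPTorsionPadic`
applies verbatim (five cited facts; no Fin_v, no Serre); recorded for the reducible X3 rows whose `K`-rational
`p`-torsion is not excluded. CONDITIONAL on the named facts.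
[cite: JetchevSkinnerWan2017, Thm. 3.3.1 (arXiv:1512.06894 p. 11)] [cite: MilneADT2006, Ch. I, Thm. 4.10 and Thm. 2.8]
[cite: Brink2007, Thm. 2] -/
theorem additiveControlOnTreeAt_of_facts_of_noPTorsionPadic'
    (hPT : ∀ (K : Type) [Field K] [NumberField K], poitouTate_selmerStructure_duality K)
    (hPT2 : ∀ (K : Type) [Field K] [NumberField K], poitouTate_sha_tateDual K)
    (hEP : ∀ (K : Type) [Field K] [NumberField K] (v : HeightOneSpectrum (𝓞 K)),
      localEulerPoincareCharacteristic (v.adicCompletion K))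
    (hcd : fieldCdLE_two_of_numberField)
    (hBr : ∀ (K : Type) [Field K] [NumberField K] (p : ℕ) [Fact p.Prime],
      ZpExtension.decomp_not_le_kerSubgroup_of_isAnticyclotomic K p)
    (W : WeierstrassCurve ℚ) [W.IsElliptic] [W.IsGloballyMinimal] (p : ℕ) [Fact p.Prime] (hp2 : p ≠ 2)
    (hadd : Addv W p) (hiv : ∀ R : (W.baseChange ℚ_[p]).toAffine.Point, p • R = 0 → R = 0)
    (K : Type) [Field K] [NumberField K] (hK : IsImaginaryQuadratic K) (hsplit : SplitsIn K p)
    (κ : ZpExtension K p) (hκ : κ.IsAnticyclotomic) (γ : Field.absoluteGaloisGroup K)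
    [Fact (κ.IsTopGenerator γ)] (𝔭 : HeightOneSpectrum (𝓞 K)) (h𝔭 : ((p : ℕ) : 𝓞 K) ∈ 𝔭.asIdeal)
    (he : 𝔭.asIdeal.ramificationIdx (𝓞 ℚ) = 1) (hf : 𝔭.asIdeal.inertiaDeg (𝓞 ℚ) = 1)
    (hrank : (W.baseChange K).mordellWeilRank = 1) (hSha : (W.baseChange K).ShaFinite)
    (P : (W.baseChange K).toAffine.Point) (hPinf : ¬ IsOfFinAddOrder P) :
    AdditiveControlOnTreeAt p κ 𝔭 γ (embAt K p 𝔭 h𝔭 he hf) P :=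
  additiveControlOnTreeAt_of_facts_of_noPTorsionPadic (hPT K) (hPT2 K) (hEP K) hcd (hBr K p) hiv hp2 hadd hK
    hsplit hκ γ 𝔭 h𝔭 he hf hrank hSha P hPinf

/-- `E(K)[p] = 0` in the `•`-form the K1 door consumes, for `ρ̄_{E,p}` IRREDUCIBLE (`[K : ℚ] = 2`; the surjective
case is Gross 1991 §2). [cite: GrossLMS1991, §2 (sentence after (2.2))] -/
theorem forall_nsmul_eq_zero_of_hasIrreducibleModPGaloisRep (W : WeierstrassCurve ℚ) [W.IsElliptic]
    (K : Type) [Field K] [NumberField K] (hK : IsImaginaryQuadratic K) {p : ℕ} [hp : Fact p.Prime]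
    (hirr : W.HasIrreducibleModPGaloisRep p) :
    ∀ x : (W.baseChange K).toAffine.Point, p • x = 0 → x = 0 := by
  intro x hx
  have h := torsionBy_eq_bot_of_isImaginaryQuadratic_of_hasIrreducibleModPGaloisRep W K hK hp.out hirr
  have hx' : x ∈ AddSubgroup.torsionBy (W.baseChange K).toAffine.Point (p : ℤ) :=
    AddSubgroup.torsionBy.nsmul_iff.mpr hx
  rw [h] at hx'
  exact (AddSubgroup.mem_bot).mp hx'

/-- **Exact anticyclotomic control on the TAME potentially supersingular class O5 (`(t′) ∪ (G)∧ss`, any odd `p`)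
with `E(K)[p] = 0`**, from the seven named facts — §2 with `hj`/`hss` supplied by the class (§1).
CONDITIONAL on the named facts.
[cite: JetchevSkinnerWan2017, Thm. 3.3.1, Prop. 3.3.4 (arXiv:1512.06894 pp. 11–13)] [cite: Brink2007, Thm. 2 and Cor. 1]
[cite: Serre1967GroupesPDivisibles, §5 Prop. 8] -/
theorem additiveControlOnTreeAt_of_classO5_of_facts
    (hPT : ∀ (K : Type) [Field K] [NumberField K], poitouTate_selmerStructure_duality K)
    (hPT2 : ∀ (K : Type) [Field K] [NumberField K], poitouTate_sha_tateDual K)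
    (hEP : ∀ (K : Type) [Field K] [NumberField K] (v : HeightOneSpectrum (𝓞 K)),
      localEulerPoincareCharacteristic (v.adicCompletion K))
    (hcd : fieldCdLE_two_of_numberField)
    (hBr : ∀ (K : Type) [Field K] [NumberField K] (p : ℕ) [Fact p.Prime],
      ZpExtension.decomp_not_le_kerSubgroup_of_isAnticyclotomic K p)
    (hBr2 : ∀ (K : Type) [Field K] [NumberField K] (p : ℕ) [Fact p.Prime],
      ZpExtension.decomp_not_le_kerSubgroup_above_of_isAnticyclotomic K p)
    (hS : Serre1967.noStableDivisibleLine_of_potentiallySupersingular)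
    (W : WeierstrassCurve ℚ) [W.IsElliptic] [W.IsGloballyMinimal] (p : ℕ) [Fact p.Prime] (hO5 : ClassO5 W p)
    (K : Type) [Field K] [NumberField K] (hK : IsImaginaryQuadratic K) (hsplit : SplitsIn K p)
    (hivK : ∀ x : (W.baseChange K).toAffine.Point, p • x = 0 → x = 0)
    (κ : ZpExtension K p) (hκ : κ.IsAnticyclotomic) (γ : Field.absoluteGaloisGroup K)
    [Fact (κ.IsTopGenerator γ)] (𝔭 : HeightOneSpectrum (𝓞 K)) (h𝔭 : ((p : ℕ) : 𝓞 K) ∈ 𝔭.asIdeal)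
    (he : 𝔭.asIdeal.ramificationIdx (𝓞 ℚ) = 1) (hf : 𝔭.asIdeal.inertiaDeg (𝓞 ℚ) = 1)
    (hrank : (W.baseChange K).mordellWeilRank = 1) (hSha : (W.baseChange K).ShaFinite)
    (P : (W.baseChange K).toAffine.Point) (hPinf : ¬ IsOfFinAddOrder P) :
    AdditiveControlOnTreeAt p κ 𝔭 γ (embAt K p 𝔭 h𝔭 he hf) P :=
  additiveControlOnTreeAt_potSS_of_facts_of_serre1967 hPT hPT2 hEP hcd hBr hBr2 hS W p hO5.1 hO5.2.1
    hO5.padicValRat_j_nonneg (fun _F _ _ _w hw hgood ↦ not_hasUnitRootAt_baseChange_of_classO5 W p hO5 hw hgood)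
    K hK hsplit hivK κ hκ γ 𝔭 h𝔭 he hf hrank hSha P hPinf

/-- **Exact anticyclotomic control on the WILD class O6 (`p = 3`) with `E(K)[3] = 0`**, from the seven named facts
— §2 with `hj`/`hss` supplied by `ClassO6.padicValRat_j_nonneg` and `not_hasUnitRootAt_baseChange_of_not_typeG_three`
(the datum-free form of gen 17's `wildSplitControlAtThree_of_facts_of_serre1967`, image hypothesis weakened from
`ρ̄_{E,3}` onto to `E(K)[3] = 0`). CONDITIONAL on the named facts.
[cite: JetchevSkinnerWan2017, Thm. 3.3.1, Prop. 3.3.4 (arXiv:1512.06894 pp. 11–13)] [cite: Brink2007, Thm. 2 and Cor. 1]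
[cite: Serre1967GroupesPDivisibles, §5 Prop. 8] -/
theorem additiveControlOnTreeAt_of_classO6_of_facts
    (hPT : ∀ (K : Type) [Field K] [NumberField K], poitouTate_selmerStructure_duality K)
    (hPT2 : ∀ (K : Type) [Field K] [NumberField K], poitouTate_sha_tateDual K)
    (hEP : ∀ (K : Type) [Field K] [NumberField K] (v : HeightOneSpectrum (𝓞 K)),
      localEulerPoincareCharacteristic (v.adicCompletion K))
    (hcd : fieldCdLE_two_of_numberField)
    (hBr : ∀ (K : Type) [Field K] [NumberField K] (p : ℕ) [Fact p.Prime],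
      ZpExtension.decomp_not_le_kerSubgroup_of_isAnticyclotomic K p)
    (hBr2 : ∀ (K : Type) [Field K] [NumberField K] (p : ℕ) [Fact p.Prime],
      ZpExtension.decomp_not_le_kerSubgroup_above_of_isAnticyclotomic K p)
    (hS : Serre1967.noStableDivisibleLine_of_potentiallySupersingular)
    (W : WeierstrassCurve ℚ) [W.IsElliptic] [W.IsGloballyMinimal] [Fact (3 : ℕ).Prime] (hO6 : ClassO6 W 3)
    (K : Type) [Field K] [NumberField K] (hK : IsImaginaryQuadratic K) (hsplit : SplitsIn K 3)
    (hivK : ∀ x : (W.baseChange K).toAffine.Point, 3 • x = 0 → x = 0)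
    (κ : ZpExtension K 3) (hκ : κ.IsAnticyclotomic) (γ : Field.absoluteGaloisGroup K)
    [Fact (κ.IsTopGenerator γ)] (𝔭 : HeightOneSpectrum (𝓞 K)) (h𝔭 : ((3 : ℕ) : 𝓞 K) ∈ 𝔭.asIdeal)
    (he : 𝔭.asIdeal.ramificationIdx (𝓞 ℚ) = 1) (hf : 𝔭.asIdeal.inertiaDeg (𝓞 ℚ) = 1)
    (hrank : (W.baseChange K).mordellWeilRank = 1) (hSha : (W.baseChange K).ShaFinite)
    (P : (W.baseChange K).toAffine.Point) (hPinf : ¬ IsOfFinAddOrder P) :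
    AdditiveControlOnTreeAt 3 κ 𝔭 γ (embAt K 3 𝔭 h𝔭 he hf) P :=
  additiveControlOnTreeAt_potSS_of_facts_of_serre1967 hPT hPT2 hEP hcd hBr hBr2 hS W 3 (by decide) hO6.2.1
    hO6.padicValRat_j_nonneg
    (fun _F _ _ _w hw hgood ↦
      not_hasUnitRootAt_baseChange_of_not_typeG_three W hO6.2.1 hO6.not_typeG_three.1 hw hgood)
    K hK hsplit hivK κ hκ γ 𝔭 h𝔭 he hf hrank hSha P hPinf

/-! ## §3 The routes' binder shape: Heegner datum, Kolyvagin as antecedent, `ρ̄_{E,p}` irreducible -/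

/-- **Exact anticyclotomic control at EVERY odd additive potentially supersingular prime, Heegner-datum form.** For
`E/ℚ` on `ClassO5 W p ∨ ClassO6 W p` with `ρ̄_{E,p}` IRREDUCIBLE (all X4 rows — surjective or not), `r_an(E) = 1`
not needed, a Heegner datum `(N, K, Dt, H, ι, P)` over an imaginary quadratic Heegner field `K` (so the additive
`p ∣ N` splits in `K`) with `P` the Heegner point of infinite order, and Kolyvagin's theorem as antecedent: control at
every anticyclotomic frame `(κ, γ, 𝔭 ∋ p)` of degree one — the binder shape of the control hypothesis `hCtl` of this
seat's kernel `UniversalToricDescentWaldspurgerFlat.bsdp_of_flatIMCEq_of_control_of_twist` (p548442) and of the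
routes' control item 20386, at a general `p`. Modulo the seven named facts. CONDITIONAL; closes nothing by itself;
BSD is not proved by any of this.
[cite: JetchevSkinnerWan2017, Thm. 3.3.1, Prop. 3.3.4 (arXiv:1512.06894 pp. 11–13)] [cite: Brink2007, Thm. 2 and Cor. 1]
[cite: Serre1967GroupesPDivisibles, §5 Prop. 8] [cite: Kolyvagin1990, Thm. A] [cite: GrossLMS1991, §2] -/
theorem additiveControl_heegner_potSS_of_facts_of_serre1967
    (hPT : ∀ (K : Type) [Field K] [NumberField K], poitouTate_selmerStructure_duality K)
    (hPT2 : ∀ (K : Type) [Field K] [NumberField K], poitouTate_sha_tateDual K)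
    (hEP : ∀ (K : Type) [Field K] [NumberField K] (v : HeightOneSpectrum (𝓞 K)),
      localEulerPoincareCharacteristic (v.adicCompletion K))
    (hcd : fieldCdLE_two_of_numberField)
    (hBr : ∀ (K : Type) [Field K] [NumberField K] (p : ℕ) [Fact p.Prime],
      ZpExtension.decomp_not_le_kerSubgroup_of_isAnticyclotomic K p)
    (hBr2 : ∀ (K : Type) [Field K] [NumberField K] (p : ℕ) [Fact p.Prime],
      ZpExtension.decomp_not_le_kerSubgroup_above_of_isAnticyclotomic K p)
    (hS : Serre1967.noStableDivisibleLine_of_potentiallySupersingular) (p : ℕ) [Fact p.Prime] :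
    ∀ (W : WeierstrassCurve ℚ) [W.IsElliptic] [W.IsGloballyMinimal] (N : ℕ) [NeZero N] (K : Type)
      [Field K] [NumberField K] (Dt : ModularParametrizationData W N)
      (H : HeegnerDatum N (NumberField.discr K)) (ι : K →+* ℂ) (P : (W.baseChange K).toAffine.Point),
      (ClassO5 W p ∨ ClassO6 W p) → W.HasIrreducibleModPGaloisRep p → W.conductorNorm ℤ = N →
      IsImaginaryQuadratic K → SatisfiesHeegnerHypothesis N K →
      WeierstrassCurve.Affine.Point.map ι.toRatAlgHom P = heegnerPointComplex Dt H →
      ¬ IsOfFinAddOrder P → kolyvagin N W K →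
      ∀ (κ : ZpExtension K p), κ.IsAnticyclotomic →
        ∀ (γ : Field.absoluteGaloisGroup K) [Fact (κ.IsTopGenerator γ)]
          (𝔭 : HeightOneSpectrum (𝓞 K)) (h𝔭 : ((p : ℕ) : 𝓞 K) ∈ 𝔭.asIdeal)
          (he : 𝔭.asIdeal.ramificationIdx (𝓞 ℚ) = 1) (hf : 𝔭.asIdeal.inertiaDeg (𝓞 ℚ) = 1),
          AdditiveControlOnTreeAt p κ 𝔭 γ (embAt K p 𝔭 h𝔭 he hf) P := by
  intro W _ _ N _ K _ _ Dt H ι P hcls hirr hN hK hHe hP hnt hKo κ hκ γ _ 𝔭 h𝔭 he hf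
  have hadd : Addv W p := hcls.elim (fun h ↦ h.2.1) (fun h ↦ h.2.1)
  have hp2 : p ≠ 2 := hcls.elim (fun h ↦ h.1) (fun h ↦ h.1)
  have hpN : p ∣ W.conductorNorm ℤ := (W.dvd_conductorNorm_iff_not_hasGoodReductionAtPrime p).mpr hadd.1
  have hsplit : SplitsIn K p := splitsIn_of_satisfiesHeegnerHypothesis hN hHe hpN
  obtain ⟨hrank, hSha⟩ := hKo hK hHe ⟨Dt, H, ι, hP⟩ hnt
  have hivK : ∀ x : (W.baseChange K).toAffine.Point, p • x = 0 → x = 0 :=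
    forall_nsmul_eq_zero_of_hasIrreducibleModPGaloisRep W K hK hirr
  have hj : 0 ≤ padicValRat p W.j := hcls.elim (fun h ↦ h.padicValRat_j_nonneg) (fun h ↦ h.padicValRat_j_nonneg)
  have hss : ∀ (F : Type) [Field F] [NumberField F] (w : HeightOneSpectrum (𝓞 F)),
      ((p : ℕ) : 𝓞 F) ∈ w.asIdeal → (W.baseChange F).HasGoodReductionAt w →
        ¬ (W.baseChange F).HasUnitRootAt w := by
    intro F _ _ w hw hgood
    rcases hcls with h5 | h6
    · exact not_hasUnitRootAt_baseChange_of_classO5 W p h5 hw hgood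
    · have h3 : p = 3 := h6.p_eq_three
      subst h3
      exact not_hasUnitRootAt_baseChange_of_not_typeG_three W h6.2.1 h6.not_typeG_three.1 hw hgood
  exact additiveControlOnTreeAt_potSS_of_facts_of_serre1967 hPT hPT2 hEP hcd hBr hBr2 hS W p hp2 hadd hj hss
    K hK hsplit hivK κ hκ γ 𝔭 h𝔭 he hf hrank hSha P hnt

/-- The same on the SURJECTIVE-image rows (`ρ̄_{E,p}` onto `GL₂(𝔽_p)` ⟹ irreducible), the binder of the routes'
cells at `p = 3`. CONDITIONAL on the seven named facts. [cite: GrossLMS1991, §2] [cite: Serre1967GroupesPDivisibles, §5 Prop. 8] -/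
theorem additiveControl_heegner_potSS_of_facts_of_serre1967_of_surjective
    (hPT : ∀ (K : Type) [Field K] [NumberField K], poitouTate_selmerStructure_duality K)
    (hPT2 : ∀ (K : Type) [Field K] [NumberField K], poitouTate_sha_tateDual K)
    (hEP : ∀ (K : Type) [Field K] [NumberField K] (v : HeightOneSpectrum (𝓞 K)),
      localEulerPoincareCharacteristic (v.adicCompletion K))
    (hcd : fieldCdLE_two_of_numberField)
    (hBr : ∀ (K : Type) [Field K] [NumberField K] (p : ℕ) [Fact p.Prime],
      ZpExtension.decomp_not_le_kerSubgroup_of_isAnticyclotomic K p)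
    (hBr2 : ∀ (K : Type) [Field K] [NumberField K] (p : ℕ) [Fact p.Prime],
      ZpExtension.decomp_not_le_kerSubgroup_above_of_isAnticyclotomic K p)
    (hS : Serre1967.noStableDivisibleLine_of_potentiallySupersingular) (p : ℕ) [Fact p.Prime] :
    ∀ (W : WeierstrassCurve ℚ) [W.IsElliptic] [W.IsGloballyMinimal] (N : ℕ) [NeZero N] (K : Type)
      [Field K] [NumberField K] (Dt : ModularParametrizationData W N)
      (H : HeegnerDatum N (NumberField.discr K)) (ι : K →+* ℂ) (P : (W.baseChange K).toAffine.Point),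
      (ClassO5 W p ∨ ClassO6 W p) → W.HasSurjectiveModNGaloisRep p → W.conductorNorm ℤ = N →
      IsImaginaryQuadratic K → SatisfiesHeegnerHypothesis N K →
      WeierstrassCurve.Affine.Point.map ι.toRatAlgHom P = heegnerPointComplex Dt H →
      ¬ IsOfFinAddOrder P → kolyvagin N W K →
      ∀ (κ : ZpExtension K p), κ.IsAnticyclotomic →
        ∀ (γ : Field.absoluteGaloisGroup K) [Fact (κ.IsTopGenerator γ)]
          (𝔭 : HeightOneSpectrum (𝓞 K)) (h𝔭 : ((p : ℕ) : 𝓞 K) ∈ 𝔭.asIdeal)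
          (he : 𝔭.asIdeal.ramificationIdx (𝓞 ℚ) = 1) (hf : 𝔭.asIdeal.inertiaDeg (𝓞 ℚ) = 1),
          AdditiveControlOnTreeAt p κ 𝔭 γ (embAt K p 𝔭 h𝔭 he hf) P := by
  intro W _ _ N _ K _ _ Dt H ι P hcls hsurj
  have hp2 : p ≠ 2 := hcls.elim (fun h ↦ h.1) (fun h ↦ h.1)
  haveI : NeZero (p : ℚ) := ⟨by exact_mod_cast (Fact.out : p.Prime).ne_zero⟩
  exact additiveControl_heegner_potSS_of_facts_of_serre1967 hPT hPT2 hEP hcd hBr hBr2 hS p W N K Dt H ι P hcls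
    (hasIrreducibleModPGaloisRep_of_hasSurjectiveModNGaloisRep W p hsurj)

end Summit.BirchSwinnertonDyer.BirchSwinnertonDyer.Theorems.AdditivePotSupersingularControl

end
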